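import Mathlib
import Summits.ResolutionOfSingularities.ResolutionOfSingularities.Theorems.HomologicalConductorPersistenceCyclicQuotientCompletionSatFourMinimal
import HarnessLib

/-!
# Rung S-2 `PersistenceSurface` (stmt-ResolutionOfSingularities-19970), stub C1 (`Sat₄`) — THE COMPLETED CYCLIC QUOTIENT IS A
# DOMAIN (analytic irreducibility of `k[u,v]^{(n;1,q)}` at its vertex)

[OURS · cell decomp-res · rung S-2; seat leafhand-res-homologicalconduct-17 gen 0]  Nothing here is a statement of the
manuscript under review (Hironaka 2017); AI-written, weaker than expert review.  DEF-FREE.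

The last side hypothesis of the toric `Sat₄` theorem (`…CyclicQuotientCompletionSatFourMinimal`: «`T̂` is a domain» for a
stage `T` with `T̂ ≃+* Ŝ`) is DISCHARGED on the model side: for `U = k[u,v]^{(n;1,q)}` (`k` any field, any `n ≥ 1`, any `q`),
its vertex `𝔪 ∋ uⁿ, vⁿ` and any localisation `S` of `U` at `𝔪`, the `𝔪`-adic completion `Ŝ` embeds into the `(u,v)`-adic
completion of `k[u,v]`, i.e. into `k[[u,v]]`, hence is a domain.  Elementary route (repair census R1, Route B of hand 17):
(D1) the `𝔪`-adic and `(u,v)`-adic filtrations on `U` are cofinal — an invariant all of whose monomials have degree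
`≥ n(j+2)` lies in `𝔪ʲ` (each invariant monomial `u^{d₀}v^{d₁}` factors as `(uⁿ)^{a₀}(vⁿ)^{a₁}·m'` with `m'` invariant and
`a₀ + a₁ ≥ j`); (D3) the compatible maps `S/𝔪ʲS → k[u,v]/(u,v)ʲ` (elements of `U ∖ 𝔪` have non-zero constant term, hence are
units modulo `(u,v)ʲ`) assemble to a ring map `Ŝ → k[u,v]^` (`AdicCompletion.liftRingHom`); (D4) it is injective by (D1);
(D5) `k[u,v]^ ≅ k[[u,v]]` (Mathlib `MvPowerSeries.toAdicCompletionAlgEquiv`) is a domain.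

* `mem_vertex_pow_of_coe_mem_pow_idealOfVars` — (D1);
* `mem_idealOfVars_of_constantCoeff_eq_zero`, `isUnit_mk_pow_idealOfVars_of_notMem_vertex` — units modulo `(u,v)ʲ`;
* `exists_ringHom_quotient_vertex_pow` — (D3) the maps `S ⧸ 𝔪_Sʲ → k[u,v] ⧸ (u,v)ʲ` with their two defining properties;
* `exists_injective_ringHom_adicCompletion_atVertex` — (D3)+(D4) an injective ring map `Ŝ →+* AdicCompletion (u,v) k[u,v]`;
* `isDomain_adicCompletion_atVertex` — **`Ŝ` is a domain**;
* `cohomologyAnnihilator_le_caAt_four_of_ringEquiv_completion_vertex''` — the toric `Sat₄` theorem with NO side hypothesis: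
  `T` noetherian local, `e : T̂ ≃+* Ŝ` ⇒ `caᵐ(T) = ca(T)` for all `m ≥ 4`.

References: M. Atiyah, I. Macdonald, *Introduction to Commutative Algebra*, Ch. 10 (completions; cofinal filtrations)
[folklore]; S. B. Iyengar, R. Takahashi, IMRN 2016 [`IyengarTakahashi2014`] (vocabulary) — Mathlib/tree lemmas only.
-/

-- single-problem summit: the doubled namespace component `ResolutionOfSingularities` is forced
set_option linter.dupNamespace false

noncomputable section

open IsLocalRing MvPolynomial Literature.RingTheory.CohomologyAnnihilator
open Summit.ResolutionOfSingularities.ResolutionOfSingularities.Theorems.HomologicalConductor.PersistenceCyclicQuotientGradedPieces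
  (whc_eq_self_iff whc_monomial)
open Summit.ResolutionOfSingularities.ResolutionOfSingularities.Theorems.HomologicalConductor.PersistenceCyclicQuotientVertexIsolated
  (X_pow_mem C_mem mem_of_constantCoeff_eq_zero)
open Summit.ResolutionOfSingularities.ResolutionOfSingularities.Theorems.HomologicalConductor.PersistenceSurfaceSaturationCommonCompletion
  (constantCoeff_eq_zero_of_mem_vertex)
open Summit.ResolutionOfSingularities.ResolutionOfSingularities.Theorems.HomologicalConductor.PersistenceCyclicQuotientCompletionSatFourMinimal
  (cohomologyAnnihilator_le_caAt_four_of_ringEquiv_completion_vertex')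

universe u

namespace Summit.ResolutionOfSingularities.ResolutionOfSingularities.Theorems.HomologicalConductor.PersistenceCyclicQuotientCompletionDomain

variable {k : Type u} [Field k] {n : ℕ} [NeZero n] {q : ℕ} (U : Subalgebra k (MvPolynomial (Fin 2) k))
variable (hU : ∀ p, p ∈ U ↔ weightedHomogeneousComponent (![1, (q : ZMod n)] : Fin 2 → ZMod n) 0 p = p)

/-! ## (D1) The two filtrations on `U` are cofinal -/

include hU in
/-- **(D1) An invariant all of whose monomials have degree `≥ n(j+2)` lies in `𝔪ʲ`.**  For `x ∈ U` with
`x ∈ (u,v)^{n(j+2)} k[u,v]`: every monomial `u^{d₀}v^{d₁}` of `x` is invariant (weight criterion) and equals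
`(uⁿ)^{a₀}(vⁿ)^{a₁} · u^{r₀}v^{r₁}` (`dᵢ = n aᵢ + rᵢ`, `rᵢ < n`) with `u^{r₀}v^{r₁}` invariant and `a₀ + a₁ ≥ j`; `uⁿ, vⁿ ∈ 𝔪`.
[folklore] -/
theorem mem_vertex_pow_of_coe_mem_pow_idealOfVars (𝔪 : Ideal U)
    (hu : (⟨(X 0 : MvPolynomial (Fin 2) k) ^ n, X_pow_mem U hU 0⟩ : U) ∈ 𝔪)
    (hv : (⟨(X 1 : MvPolynomial (Fin 2) k) ^ n, X_pow_mem U hU 1⟩ : U) ∈ 𝔪) (j : ℕ) (x : U)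
    (hx : (x : MvPolynomial (Fin 2) k) ∈ idealOfVars (Fin 2) k ^ (n * (j + 2))) : x ∈ 𝔪 ^ j := by
  have hnpos : 0 < n := Nat.pos_of_ne_zero (NeZero.ne n)
  -- every monomial of an invariant is invariant
  have hwt : ∀ d ∈ (x : MvPolynomial (Fin 2) k).support, ((d 0 + q * d 1 : ℕ) : ZMod n) = 0 :=
    (whc_eq_self_iff q 0 _).mp ((hU _).mp x.2)
  have hmon : ∀ d ∈ (x : MvPolynomial (Fin 2) k).support, ∀ c : k, monomial d c ∈ U := by
    intro d hd c
    rw [hU, ← hwt d hd]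
    exact whc_monomial q d c
  -- every monomial has degree `≥ n (j + 2)`
  have hdeg : ∀ d ∈ (x : MvPolynomial (Fin 2) k).support, n * (j + 2) ≤ d 0 + d 1 := by
    intro d hd
    have h := (mem_pow_idealOfVars_iff _ _).mp hx d hd
    rwa [Finsupp.degree_eq_sum, Fin.sum_univ_two] at h
  -- each invariant monomial of `x` lies in `𝔪 ^ j`
  have hmonp : ∀ d (hd : d ∈ (x : MvPolynomial (Fin 2) k).support) (c : k),
      (⟨monomial d c, hmon d hd c⟩ : U) ∈ 𝔪 ^ j := by
    intro d hd c
    have hsplit : (⟨monomial d c, hmon d hd c⟩ : U) = ⟨C c, C_mem U hU c⟩ * ⟨monomial d 1, hmon d hd 1⟩ := by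
      apply Subtype.ext
      change monomial d c = C c * monomial d 1
      rw [C_mul_monomial, mul_one]
    rw [hsplit]
    refine Ideal.mul_mem_left _ _ ?_
    -- `dᵢ = n aᵢ + rᵢ`
    set a0 := d 0 / n with ha0
    set r0 := d 0 % n with hr0
    set a1 := d 1 / n with ha1
    set r1 := d 1 % n with hr1
    have h0 : d 0 = n * a0 + r0 := (Nat.div_add_mod (d 0) n).symm
    have h1 : d 1 = n * a1 + r1 := (Nat.div_add_mod (d 1) n).symm
    have hr0n : r0 < n := Nat.mod_lt _ hnpos
    have hr1n : r1 < n := Nat.mod_lt _ hnpos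
    -- `a0 + a1 ≥ j`
    have hj : j ≤ a0 + a1 := by
      have hsum := hdeg d hd
      have hlt : n * j < n * (a0 + a1 + 1) := by nlinarith
      have := Nat.lt_of_mul_lt_mul_left hlt
      omega
    -- the residual invariant monomial `u^{r0} v^{r1}`
    let r : Fin 2 →₀ ℕ := Finsupp.single 0 r0 + Finsupp.single 1 r1
    have hr0' : r 0 = r0 := by simp [r]
    have hr1' : r 1 = r1 := by simp [r]
    have hrw : ((r 0 + q * r 1 : ℕ) : ZMod n) = 0 := by
      rw [hr0', hr1', ← hwt d hd, h0, h1]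
      push_cast
      rw [ZMod.natCast_self]
      ring
    have hr_mem : monomial r (1 : k) ∈ U := by
      rw [hU, ← hrw]
      exact whc_monomial q r 1
    have hfac : (⟨monomial d 1, hmon d hd 1⟩ : U) =
        (⟨(X 0 : MvPolynomial (Fin 2) k) ^ n, X_pow_mem U hU 0⟩ : U) ^ a0 *
          (⟨(X 1 : MvPolynomial (Fin 2) k) ^ n, X_pow_mem U hU 1⟩ : U) ^ a1 * ⟨monomial r 1, hr_mem⟩ := by
      have hd' : d = Finsupp.single 0 (n * a0) + Finsupp.single 1 (n * a1) + r := by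
        ext i; fin_cases i <;> simp [r, h0, h1]
      apply Subtype.ext
      change monomial d (1 : k) = ((X 0 : MvPolynomial (Fin 2) k) ^ n) ^ a0 * ((X 1) ^ n) ^ a1 * monomial r 1
      rw [← pow_mul, ← pow_mul, X_pow_eq_monomial, X_pow_eq_monomial, monomial_mul, monomial_mul, mul_one, mul_one,
        ← hd']
    rw [hfac]
    refine Ideal.mul_mem_right _ _ (Ideal.pow_le_pow_right hj ?_)
    rw [pow_add]
    exact Ideal.mul_mem_mul (Ideal.pow_mem_pow hu a0) (Ideal.pow_mem_pow hv a1)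
  -- sum over the support
  have hsum : x = ∑ d ∈ (x : MvPolynomial (Fin 2) k).support.attach,
      (⟨monomial d.1 (coeff d.1 (x : MvPolynomial (Fin 2) k)), hmon d.1 d.2 _⟩ : U) := by
    apply Subtype.ext
    rw [AddSubmonoidClass.coe_finsetSum]
    rw [Finset.sum_attach (x : MvPolynomial (Fin 2) k).support
      (fun d => monomial d (coeff d (x : MvPolynomial (Fin 2) k)))]
    exact (x : MvPolynomial (Fin 2) k).as_sum
  rw [hsum]
  exact Ideal.sum_mem _ fun d _ => hmonp d.1 d.2 _

/-! ## Units modulo `(u,v)ʲ` -/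

omit [NeZero n] in
/-- A polynomial with zero constant term lies in the ideal of the variables. [folklore] -/
theorem mem_idealOfVars_of_constantCoeff_eq_zero (p : MvPolynomial (Fin 2) k) (hp : constantCoeff p = 0) :
    p ∈ idealOfVars (Fin 2) k := by
  rw [← pow_one (idealOfVars (Fin 2) k), mem_pow_idealOfVars_iff]
  intro d hd
  rw [Nat.one_le_iff_ne_zero, Ne, Finsupp.degree_eq_zero_iff]
  rintro rfl
  rw [mem_support_iff, ← constantCoeff_eq, hp] at hd
  exact hd rfl

include hU in
/-- **An invariant outside the vertex is a unit modulo `(u,v)ʲ`**: `y ∈ U ∖ 𝔪` has non-zero constant term `c`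
(`…VertexIsolated.mem_of_constantCoeff_eq_zero`), and `y = c + (y − c)` with `y − c ∈ (u,v)` nilpotent modulo `(u,v)ʲ`.
[folklore] -/
theorem isUnit_mk_pow_idealOfVars_of_notMem_vertex (𝔪 : Ideal U) [𝔪.IsPrime]
    (hu : (⟨(X 0 : MvPolynomial (Fin 2) k) ^ n, X_pow_mem U hU 0⟩ : U) ∈ 𝔪)
    (hv : (⟨(X 1 : MvPolynomial (Fin 2) k) ^ n, X_pow_mem U hU 1⟩ : U) ∈ 𝔪) (j : ℕ) (y : U) (hy : y ∉ 𝔪) :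
    IsUnit (Ideal.Quotient.mk (idealOfVars (Fin 2) k ^ j) (y : MvPolynomial (Fin 2) k)) := by
  set c := constantCoeff (y : MvPolynomial (Fin 2) k) with hc
  have hc0 : c ≠ 0 := fun h => hy (mem_of_constantCoeff_eq_zero U hU 𝔪 hu hv y h)
  have hy0 : (y : MvPolynomial (Fin 2) k) - C c ∈ idealOfVars (Fin 2) k :=
    mem_idealOfVars_of_constantCoeff_eq_zero _ (by rw [map_sub, constantCoeff_C, ← hc, sub_self])
  have hnil : IsNilpotent (Ideal.Quotient.mk (idealOfVars (Fin 2) k ^ j) ((y : MvPolynomial (Fin 2) k) - C c)) :=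
    ⟨j, by rw [← map_pow, Ideal.Quotient.eq_zero_iff_mem]; exact Ideal.pow_mem_pow hy0 j⟩
  have hunit : IsUnit (Ideal.Quotient.mk (idealOfVars (Fin 2) k ^ j) (C c)) :=
    ((isUnit_iff_ne_zero.mpr hc0).map C).map _
  have h := hnil.isUnit_add_left_of_commute hunit (Commute.all _ _)
  rwa [← map_add, add_sub_cancel] at h

/-! ## (D3) The maps `S ⧸ 𝔪_Sʲ → k[u,v] ⧸ (u,v)ʲ` -/

include hU in
/-- **(D3) The level-`j` comparison map.**  For the vertex `𝔪` and a localisation `S` of `U` at `𝔪` there is a ring map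
`h : S ⧸ 𝔪_Sʲ →+* k[u,v] ⧸ (u,v)ʲ` with `h (a/1) = a mod (u,v)ʲ` for `a ∈ U`, and such that every `s ∈ S` with `h (s̄) = 0`
satisfies `s ∈ 𝔪_S^{j'}` as soon as `n(j'+2) ≤ j` (by (D1)). [folklore] -/
theorem exists_ringHom_quotient_vertex_pow (𝔪 : Ideal U) [𝔪.IsMaximal]
    (hu : (⟨(X 0 : MvPolynomial (Fin 2) k) ^ n, X_pow_mem U hU 0⟩ : U) ∈ 𝔪)
    (hv : (⟨(X 1 : MvPolynomial (Fin 2) k) ^ n, X_pow_mem U hU 1⟩ : U) ∈ 𝔪)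
    (S : Type u) [CommRing S] [Algebra U S] [IsLocalization.AtPrime S 𝔪] [IsLocalRing S] (j : ℕ) :
    ∃ h : S ⧸ maximalIdeal S ^ j →+* MvPolynomial (Fin 2) k ⧸ idealOfVars (Fin 2) k ^ j,
      (∀ a : U, h (Ideal.Quotient.mk _ (algebraMap U S a)) =
        Ideal.Quotient.mk _ (a : MvPolynomial (Fin 2) k)) ∧
      (∀ (j' : ℕ), n * (j' + 2) ≤ j → ∀ s : S, h (Ideal.Quotient.mk _ s) = 0 → s ∈ maximalIdeal S ^ j') := by
  -- the map `g : S → k[u,v] ⧸ (u,v)ʲ`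
  let g₀ : U →+* MvPolynomial (Fin 2) k ⧸ idealOfVars (Fin 2) k ^ j :=
    (Ideal.Quotient.mk _).comp (algebraMap U (MvPolynomial (Fin 2) k))
  have hunits : ∀ y : 𝔪.primeCompl, IsUnit (g₀ y) := fun y =>
    isUnit_mk_pow_idealOfVars_of_notMem_vertex U hU 𝔪 hu hv j y.1 y.2
  let g : S →+* MvPolynomial (Fin 2) k ⧸ idealOfVars (Fin 2) k ^ j := IsLocalization.lift (M := 𝔪.primeCompl) hunits
  have hg : ∀ a : U, g (algebraMap U S a) = Ideal.Quotient.mk _ (a : MvPolynomial (Fin 2) k) := fun a =>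
    IsLocalization.lift_eq (M := 𝔪.primeCompl) hunits a
  -- `𝔪` maps into `(u,v)`, so `𝔪_Sʲ = 𝔪ʲ S` is killed by `g`
  have hmI : ∀ a : U, a ∈ 𝔪 → (a : MvPolynomial (Fin 2) k) ∈ idealOfVars (Fin 2) k := fun a ha =>
    mem_idealOfVars_of_constantCoeff_eq_zero _ (constantCoeff_eq_zero_of_mem_vertex U hU 𝔪 hu hv a ha)
  have hker : maximalIdeal S ^ j ≤ RingHom.ker g := by
    rw [← IsLocalization.AtPrime.map_eq_maximalIdeal 𝔪 S, ← Ideal.map_pow, Ideal.map_le_iff_le_comap]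
    have hle : 𝔪 ^ j ≤ (idealOfVars (Fin 2) k ^ j).comap (algebraMap U (MvPolynomial (Fin 2) k)) := by
      rw [← Ideal.map_le_iff_le_comap, Ideal.map_pow]
      exact Ideal.pow_right_mono (Ideal.map_le_iff_le_comap.mpr fun a ha => Ideal.mem_comap.mpr (hmI a ha)) j
    intro a ha
    rw [Ideal.mem_comap, RingHom.mem_ker, hg, Ideal.Quotient.eq_zero_iff_mem]
    exact hle ha
  refine ⟨Ideal.Quotient.lift _ g fun s hs => hker hs, fun a => by rw [Ideal.Quotient.lift_mk]; exact hg a, ?_⟩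
  intro j' hj' s hs
  rw [Ideal.Quotient.lift_mk] at hs
  -- write `s = a / t`
  obtain ⟨⟨a, t⟩, hat⟩ := IsLocalization.mk'_surjective 𝔪.primeCompl s
  simp only at hat
  subst hat
  have hga : g₀ a = 0 := by
    have h := (IsLocalization.lift_mk'_spec (M := 𝔪.primeCompl) hunits a 0 t).mp hs
    rwa [mul_zero] at h
  have hga' : (a : MvPolynomial (Fin 2) k) ∈ idealOfVars (Fin 2) k ^ j := Ideal.Quotient.eq_zero_iff_mem.mp hga
  have ha : a ∈ 𝔪 ^ j' :=
    mem_vertex_pow_of_coe_mem_pow_idealOfVars U hU 𝔪 hu hv j' a (Ideal.pow_le_pow_right hj' hga')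
  rw [← IsLocalization.AtPrime.map_eq_maximalIdeal 𝔪 S, ← Ideal.map_pow, IsLocalization.mk'_eq_mul_mk'_one]
  exact Ideal.mul_mem_right _ _ (Ideal.mem_map_of_mem _ ha)

/-! ## (D3)+(D4) An injective ring map `Ŝ → k[u,v]^` -/

include hU in
/-- **(D3)+(D4) `Ŝ` embeds into the `(u,v)`-adic completion of `k[u,v]`.**  The level maps of
`exists_ringHom_quotient_vertex_pow`, composed with `AdicCompletion.evalₐ`, form a compatible family and lift
(`AdicCompletion.liftRingHom`) to `Φ : Ŝ →+* k[u,v]^`; if `Φ x = 0` then every level of `x` vanishes — level `j` because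
level `n(j+2)` of `Φ x` does (D1) — so `x = 0` (`AdicCompletion.ext_evalₐ`). [folklore] -/
theorem exists_injective_ringHom_adicCompletion_atVertex (𝔪 : Ideal U) [𝔪.IsMaximal]
    (hu : (⟨(X 0 : MvPolynomial (Fin 2) k) ^ n, X_pow_mem U hU 0⟩ : U) ∈ 𝔪)
    (hv : (⟨(X 1 : MvPolynomial (Fin 2) k) ^ n, X_pow_mem U hU 1⟩ : U) ∈ 𝔪)
    (S : Type u) [CommRing S] [Algebra U S] [IsLocalization.AtPrime S 𝔪] [IsLocalRing S] :
    ∃ Φ : AdicCompletion (maximalIdeal S) S →+*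
        AdicCompletion (idealOfVars (Fin 2) k) (MvPolynomial (Fin 2) k), Function.Injective Φ := by
  choose h hh hker using exists_ringHom_quotient_vertex_pow U hU 𝔪 hu hv S
  -- the family `f j = h j ∘ eval j`
  let f : (j : ℕ) → AdicCompletion (maximalIdeal S) S →+* MvPolynomial (Fin 2) k ⧸ idealOfVars (Fin 2) k ^ j :=
    fun j => (h j).comp (AdicCompletion.evalₐ (maximalIdeal S) j).toRingHom
  -- `h j` agrees with `h j'` modulo `(u,v)ʲ` on `S` (both are determined on `U`)
  have hcompat_S : ∀ {i j : ℕ} (hle : i ≤ j) (s : S),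
      Ideal.Quotient.factorPow (idealOfVars (Fin 2) k) hle (h j (Ideal.Quotient.mk _ s)) =
        h i (Ideal.Quotient.mk _ s) := by
    intro i j hle s
    -- both sides are ring maps `S → k[u,v] ⧸ (u,v)ⁱ` agreeing on `U`
    have key : ((Ideal.Quotient.factorPow (idealOfVars (Fin 2) k) hle).comp
        ((h j).comp (Ideal.Quotient.mk (maximalIdeal S ^ j)))) =
        (h i).comp (Ideal.Quotient.mk (maximalIdeal S ^ i)) := by
      refine IsLocalization.ringHom_ext 𝔪.primeCompl (RingHom.ext fun a => ?_)
      simp only [RingHom.comp_apply]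
      rw [hh j a, hh i a]
      rfl
    exact congrArg (fun φ : S →+* _ => φ s) key
  have hf : ∀ {i j : ℕ} (hle : i ≤ j),
      (Ideal.Quotient.factorPow (idealOfVars (Fin 2) k) hle).comp (f j) = f i := by
    intro i j hle
    refine RingHom.ext fun x => ?_
    induction x using AdicCompletion.induction_on with
    | h r =>
      simp only [f, RingHom.comp_apply, AlgHom.toRingHom_eq_coe, RingHom.coe_coe, AdicCompletion.evalₐ_mk]
      rw [hcompat_S hle, AdicCompletion.Ideal.mk_eq_mk (maximalIdeal S) hle r]
  refine ⟨AdicCompletion.liftRingHom (idealOfVars (Fin 2) k) f hf, ?_⟩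
  rw [injective_iff_map_eq_zero]
  intro x hx
  refine AdicCompletion.ext_evalₐ fun j => ?_
  rw [map_zero]
  -- level `n (j + 2)` of `Φ x` vanishes
  have hN : f (n * (j + 2)) x = 0 := by
    rw [← AdicCompletion.evalₐ_liftRingHom (idealOfVars (Fin 2) k) f hf (n * (j + 2)) x, hx, map_zero]
  -- hence level `j` of `x` vanishes
  induction x using AdicCompletion.induction_on with
  | h r =>
    simp only [f, RingHom.comp_apply, AlgHom.toRingHom_eq_coe, RingHom.coe_coe, AdicCompletion.evalₐ_mk] at hN
    rw [AdicCompletion.evalₐ_mk, Ideal.Quotient.eq_zero_iff_mem]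
    have hle : j ≤ n * (j + 2) := by nlinarith [Nat.pos_of_ne_zero (NeZero.ne n)]
    have hmem := hker (n * (j + 2)) j le_rfl (r.val (n * (j + 2))) hN
    have hdiff : r.val (n * (j + 2)) - r.val j ∈ maximalIdeal S ^ j :=
      Ideal.Quotient.eq.mp (AdicCompletion.Ideal.mk_eq_mk (maximalIdeal S) hle r)
    have : r.val j = r.val (n * (j + 2)) - (r.val (n * (j + 2)) - r.val j) := by ring
    rw [this]
    exact Ideal.sub_mem _ hmem hdiff

/-! ## `Ŝ` is a domain; the toric `Sat₄` theorem with no side hypothesis -/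

include hU in
/-- **THE COMPLETED CYCLIC QUOTIENT IS A DOMAIN.**  For `U = k[u,v]^{(n;1,q)}` (any field `k`, any `n ≥ 1`, any `q`), its
vertex `𝔪 ∋ uⁿ, vⁿ` and any localisation `S` of `U` at `𝔪`, the `𝔪`-adic completion `Ŝ` is an integral domain: it embeds
into `k[u,v]^ ≅ k[[u,v]]`. [folklore] -/
theorem isDomain_adicCompletion_atVertex (𝔪 : Ideal U) [𝔪.IsMaximal]
    (hu : (⟨(X 0 : MvPolynomial (Fin 2) k) ^ n, X_pow_mem U hU 0⟩ : U) ∈ 𝔪)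
    (hv : (⟨(X 1 : MvPolynomial (Fin 2) k) ^ n, X_pow_mem U hU 1⟩ : U) ∈ 𝔪)
    (S : Type u) [CommRing S] [Algebra U S] [IsLocalization.AtPrime S 𝔪] [IsLocalRing S] :
    IsDomain (AdicCompletion (maximalIdeal S) S) := by
  obtain ⟨Φ, hΦ⟩ := exists_injective_ringHom_adicCompletion_atVertex U hU 𝔪 hu hv S
  haveI : IsDomain (MvPowerSeries (Fin 2) k) := NoZeroDivisors.to_isDomain _
  haveI : IsDomain (AdicCompletion (idealOfVars (Fin 2) k) (MvPolynomial (Fin 2) k)) :=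
    MulEquiv.isDomain (MvPowerSeries (Fin 2) k) (MvPowerSeries.toAdicCompletionAlgEquiv (Fin 2) k).symm.toMulEquiv
  exact hΦ.isDomain Φ

include hU in
/-- **`Sat₄` AT EVERY ANALYTICALLY-TORIC SURFACE STAGE — no side hypothesis.**  `U = k[u,v]^{(n;1,q)}` (`gcd(q,n) = 1`, `k`
any field), `𝔪 ∋ uⁿ, vⁿ` its vertex, `S` any noetherian local localisation of `U` at `𝔪`, `T` any noetherian local ring with
`e : T̂ ≃+* Ŝ`.  Then `ca(T) ⊆ ca⁴(T)`. [OURS · cell decomp-res] -/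
theorem cohomologyAnnihilator_le_caAt_four_of_ringEquiv_completion_vertex'' (hq : q.Coprime n) (𝔪 : Ideal U)
    [𝔪.IsMaximal] (hu : (⟨(X 0 : MvPolynomial (Fin 2) k) ^ n, X_pow_mem U hU 0⟩ : U) ∈ 𝔪)
    (hv : (⟨(X 1 : MvPolynomial (Fin 2) k) ^ n, X_pow_mem U hU 1⟩ : U) ∈ 𝔪)
    (S : Type u) [CommRing S] [Algebra U S] [IsLocalization.AtPrime S 𝔪] [IsNoetherianRing S] [IsLocalRing S]
    {T : Type u} [CommRing T] [IsNoetherianRing T] [IsLocalRing T]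
    (e : AdicCompletion (maximalIdeal T) T ≃+* AdicCompletion (maximalIdeal S) S) :
    cohomologyAnnihilator T ≤ cohomologyAnnihilatorOfDegree T 4 := by
  haveI := isDomain_adicCompletion_atVertex U hU 𝔪 hu hv S
  haveI : IsDomain (AdicCompletion (maximalIdeal T) T) := MulEquiv.isDomain _ e.toMulEquiv
  exact cohomologyAnnihilator_le_caAt_four_of_ringEquiv_completion_vertex' U hU hq 𝔪 hu hv S e

include hU in
/-- **`caᵐ(T) = ca(T)` for all `m ≥ 4` at every analytically-toric surface stage — no side hypothesis** (`T` noetherian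
local, `e : T̂ ≃+* Ŝ`). [OURS · cell decomp-res] -/
theorem cohomologyAnnihilatorOfDegree_eq_of_ringEquiv_completion_vertex'' (hq : q.Coprime n) (𝔪 : Ideal U)
    [𝔪.IsMaximal] (hu : (⟨(X 0 : MvPolynomial (Fin 2) k) ^ n, X_pow_mem U hU 0⟩ : U) ∈ 𝔪)
    (hv : (⟨(X 1 : MvPolynomial (Fin 2) k) ^ n, X_pow_mem U hU 1⟩ : U) ∈ 𝔪)
    (S : Type u) [CommRing S] [Algebra U S] [IsLocalization.AtPrime S 𝔪] [IsNoetherianRing S] [IsLocalRing S]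
    {T : Type u} [CommRing T] [IsNoetherianRing T] [IsLocalRing T]
    (e : AdicCompletion (maximalIdeal T) T ≃+* AdicCompletion (maximalIdeal S) S) {m : ℕ} (hm : 4 ≤ m) :
    cohomologyAnnihilatorOfDegree T m = cohomologyAnnihilator T :=
  le_antisymm (cohomologyAnnihilatorOfDegree_le m)
    ((cohomologyAnnihilator_le_caAt_four_of_ringEquiv_completion_vertex'' U hU hq 𝔪 hu hv S e).trans
      (cohomologyAnnihilatorOfDegree_mono hm))

end Summit.ResolutionOfSingularities.ResolutionOfSingularities.Theorems.HomologicalConductor.PersistenceCyclicQuotientCompletionDomain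

end
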